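import Summits.ResolutionOfSingularities.ResolutionOfSingularities.Theorems.MarkedTransferCampaignW36ThreeLines
import HarnessLib

/-!
# [OURS · L1 W3.6 / K3.6 specimen (B)] Three concurrent lines, part 2: `xyz ∉ I²` (the ord-pow door FAILS at level 2) and
# VERONESE STABILITY AT LEVEL 2, `(I^{(2)})^m = I^{(2m)}` (companion of `MarkedTransferCampaignW36ThreeLines.lean`)

Cell `res-hironaka`, rung L slot W3.6 «ORD-POW CUT» / kill test K3.6 specimen (B) (RESCUE-SEED v0.6.3 §1 W3.6; res-type-010 K3.6
AMENDMENT 1 2026-08-27T01:04:14Z «(B) predicted level-2 core focus»). HOST: `Theses.MarkedTransfer.HypersurfaceOrderReduction`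
(stmt-ResolutionOfSingularities-16155), `--supports … --as helper`. Author seat: res-type-009 (RESERVE), STATUS 2026-08-27T01:17:30Z.

HONEST FRAMING. Elementary commutative algebra about monomial ideals in `k[x,y,z]`; NOTHING here is a statement of H. Hironaka's
manuscript (2017, [Hironaka2017]) and no candidate statement of it is used as a premise. With the notation of part 1
(`I = (xy,yz,zx)`, `I^{(n)} = (x,y)^n ∩ (y,z)^n ∩ (z,x)^n = symbPow n`):
* `X012_not_mem_sq` — `xyz ∉ I²` over a non-trivial `k` (every monomial of `I²` has degree `≥ 4`), hence `symbPow_two_ne_sq`: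
  `I^{(2)} ≠ I²` — ordinary square ≠ symbolic square: «OrdPowAlong» FAILS for the three concurrent lines (`not_symbPow_two_le_one_sq`:
  level `1` is not Veronese-stable), as res-L1-type-o4 predicted for specimen (B);
* **`symbPow_two_pow`** — `(I^{(2)})^m = I^{(2m)}` for every `m`: the `2`-nd Veronese sub-algebra of `⊕_n I^{(n)}` is generated in
  degree one — the ring-level form of the hypothesis `𝓘^{⟨k·b₀⟩} ≤ (𝓘^{⟨b₀⟩})^k ∀ k` of `Lib/CoreFocusVeronese.stableAt_of_veronese`
  (res-type-010, p480948) with `b₀ = 2` (`symbPow_mul_two_le_pow`).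
The SHEAF-level statement for `Σ̄_max(E_B) ⊂ 𝔸⁴` (identification of `diffPower` with these ideals; the transversal parameter `w`) is
NOT claimed here. AI-produced kernel evidence, weaker than expert review.
-/

noncomputable section

set_option linter.dupNamespace false -- mandated namespace of this single-conjunct summit

namespace Summit.ResolutionOfSingularities.ResolutionOfSingularities.Theorems

namespace CampaignW36

namespace ThreeLines

open MvPolynomial
open scoped Pointwise

variable {k : Type*} [CommRing k]

/-! ## `xyz ∉ I²`: ordinary and symbolic square differ -/

/-- The total-degree weight `d ↦ d₀ + d₁ + d₂`. -/
def totWeight : (Fin 3 →₀ ℕ) →+ ℕ :=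
  Finsupp.applyAddHom 0 + Finsupp.applyAddHom 1 + Finsupp.applyAddHom 2

/-- `totWeight d = d₀ + d₁ + d₂`. -/
@[simp] theorem totWeight_apply (d : Fin 3 →₀ ℕ) : totWeight d = d 0 + d 1 + d 2 := rfl

/-- `I ⊆ W_tot(2)` (the generators are quadratic monomials). -/
theorem I_le_wIdeal_tot_two : I (k := k) ≤ wIdeal totWeight 2 := by
  rw [I, Ideal.span_le]
  intro f hf
  simp only [Set.mem_insert_iff, Set.mem_singleton_iff] at hf
  rw [SetLike.mem_coe]
  rcases hf with rfl | rfl | rfl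
  · have : (X 0 * X 1 : R k) = monomial (Finsupp.single 0 1 + Finsupp.single 1 1) 1 := by
      rw [X, X, monomial_mul, mul_one]
    rw [this]; exact monomial_mem_wIdeal (by simp) 1
  · have : (X 1 * X 2 : R k) = monomial (Finsupp.single 1 1 + Finsupp.single 2 1) 1 := by
      rw [X, X, monomial_mul, mul_one]
    rw [this]; exact monomial_mem_wIdeal (by simp) 1
  · have : (X 0 * X 2 : R k) = monomial (Finsupp.single 0 1 + Finsupp.single 2 1) 1 := by
      rw [X, X, monomial_mul, mul_one]
    rw [this]; exact monomial_mem_wIdeal (by simp) 1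

/-- **`xyz ∉ I²`** (over a non-trivial `k`): `I²` consists of polynomials with monomials of degree `≥ 4`, `xyz` has degree `3`.
Hence the ordinary square `I²` is STRICTLY smaller than the symbolic square `I^{(2)}` — «OrdPowAlong» FAILS for the three
concurrent lines. -/
theorem X012_not_mem_sq [Nontrivial k] : (X 0 * X 1 * X 2 : R k) ∉ I ^ 2 := by
  intro h
  have h4 : (X 0 * X 1 * X 2 : R k) ∈ wIdeal totWeight 4 := by
    have hle : I (k := k) ^ 2 ≤ wIdeal totWeight (2 * 2) :=
      le_trans (Ideal.pow_right_mono I_le_wIdeal_tot_two 2) (wIdeal_pow_le totWeight 2 2)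
    exact hle h
  rw [X012_eq] at h4
  have := le_of_monomial_mem_wIdeal one_ne_zero h4
  simp at this

/-- **`I^{(2)} ≠ I²`** (non-trivial `k`). -/
theorem symbPow_two_ne_sq [Nontrivial k] : symbPow (k := k) 2 ≠ I ^ 2 := fun h =>
  X012_not_mem_sq (h ▸ X012_mem_symbPow_two)

/-! ## Veronese stability at level 2: `(I^{(2)})^m = I^{(2m)}` -/

/-- A monomial of `I^{(2m)}` lies in `(I^{(2)})^m`: peel off `xyz` while all exponents are positive, else a square `(X_iX_j)²`
per remaining level. -/
theorem monomial_mem_symbPow_two_pow :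
    ∀ (m : ℕ) (d : Fin 3 →₀ ℕ), 2 * m ≤ d 0 + d 1 → 2 * m ≤ d 1 + d 2 → 2 * m ≤ d 0 + d 2 →
      monomial d (1 : k) ∈ symbPow 2 ^ m := by
  classical
  intro m
  induction m with
  | zero => intro d _ _ _; simp
  | succ m ih =>
    intro d h01 h12 h02
    by_cases hpos : 1 ≤ d 0 ∧ 1 ≤ d 1 ∧ 1 ≤ d 2
    · -- factor `xyz ∈ I^{(2)}` and recurse
      have hle : e111 ≤ d := by
        intro l; fin_cases l <;> simp [hpos.1, hpos.2.1, hpos.2.2]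
      have hmon : monomial d (1 : k) = (X 0 * X 1 * X 2) * monomial (d - e111) 1 := by
        rw [X012_eq, monomial_mul, mul_one, add_tsub_cancel_of_le hle]
      rw [hmon, pow_succ']
      refine Ideal.mul_mem_mul X012_mem_symbPow_two (ih _ ?_ ?_ ?_) <;>
        simp only [Finsupp.coe_tsub, Pi.sub_apply, e111_apply] <;> omega
    · -- one exponent vanishes: the other two are `≥ 2(m+1)`; `(X_i X_j)^{2}` lies in `I^{(2)}`, its `(m+1)`-st power divides
      by_cases h0 : d 0 = 0
      · have h1 : 2 * (m + 1) ≤ d 1 := by omega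
        have h2 : 2 * (m + 1) ≤ d 2 := by omega
        set e : Fin 3 →₀ ℕ := Finsupp.single 1 (2 * (m + 1)) + Finsupp.single 2 (2 * (m + 1)) with he
        have hle : e ≤ d := by
          intro l; fin_cases l <;> simp [he] <;> omega
        have hsq : (monomial (Finsupp.single (1 : Fin 3) 2 + Finsupp.single 2 2) (1 : k)) ∈ symbPow 2 :=
          monomial_mem_symbPow (by simp) (by simp) (by simp) 1
        have hmon : monomial d (1 : k) =
            (monomial (Finsupp.single (1 : Fin 3) 2 + Finsupp.single 2 2) (1 : k)) ^ (m + 1) * monomial (d - e) 1 := by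
          rw [monomial_pow, one_pow, monomial_mul, mul_one, smul_add, Finsupp.smul_single, Finsupp.smul_single,
            smul_eq_mul, mul_comm (m + 1) 2, ← he, add_tsub_cancel_of_le hle]
        rw [hmon]
        exact Ideal.mul_mem_right _ _ (Ideal.pow_mem_pow hsq _)
      · by_cases h1 : d 1 = 0
        · have h0' : 2 * (m + 1) ≤ d 0 := by omega
          have h2 : 2 * (m + 1) ≤ d 2 := by omega
          set e : Fin 3 →₀ ℕ := Finsupp.single 0 (2 * (m + 1)) + Finsupp.single 2 (2 * (m + 1)) with he
          have hle : e ≤ d := by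
            intro l; fin_cases l <;> simp [he] <;> omega
          have hsq : (monomial (Finsupp.single (0 : Fin 3) 2 + Finsupp.single 2 2) (1 : k)) ∈ symbPow 2 :=
            monomial_mem_symbPow (by simp) (by simp) (by simp) 1
          have hmon : monomial d (1 : k) =
              (monomial (Finsupp.single (0 : Fin 3) 2 + Finsupp.single 2 2) (1 : k)) ^ (m + 1) * monomial (d - e) 1 := by
            rw [monomial_pow, one_pow, monomial_mul, mul_one, smul_add, Finsupp.smul_single, Finsupp.smul_single,
              smul_eq_mul, mul_comm (m + 1) 2, ← he, add_tsub_cancel_of_le hle]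
          rw [hmon]
          exact Ideal.mul_mem_right _ _ (Ideal.pow_mem_pow hsq _)
        · have h2 : d 2 = 0 := by omega
          have h0' : 2 * (m + 1) ≤ d 0 := by omega
          have h1' : 2 * (m + 1) ≤ d 1 := by omega
          set e : Fin 3 →₀ ℕ := Finsupp.single 0 (2 * (m + 1)) + Finsupp.single 1 (2 * (m + 1)) with he
          have hle : e ≤ d := by
            intro l; fin_cases l <;> simp [he] <;> omega
          have hsq : (monomial (Finsupp.single (0 : Fin 3) 2 + Finsupp.single 1 2) (1 : k)) ∈ symbPow 2 :=
            monomial_mem_symbPow (by simp) (by simp) (by simp) 1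
          have hmon : monomial d (1 : k) =
              (monomial (Finsupp.single (0 : Fin 3) 2 + Finsupp.single 1 2) (1 : k)) ^ (m + 1) * monomial (d - e) 1 := by
            rw [monomial_pow, one_pow, monomial_mul, mul_one, smul_add, Finsupp.smul_single, Finsupp.smul_single,
              smul_eq_mul, mul_comm (m + 1) 2, ← he, add_tsub_cancel_of_le hle]
          rw [hmon]
          exact Ideal.mul_mem_right _ _ (Ideal.pow_mem_pow hsq _)

/-- **VERONESE STABILITY AT LEVEL 2: `(I^{(2)})^m = I^{(2m)}`** for every `m` — the `2`-nd Veronese sub-algebra of the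
symbolic Rees algebra `⊕_n I^{(n)}` is generated in degree one (ring-level form of the hypothesis of
`Lib/CoreFocusVeronese.stableAt_of_veronese` for the three concurrent lines). -/
theorem symbPow_two_pow (m : ℕ) : symbPow (k := k) 2 ^ m = symbPow (2 * m) := by
  refine le_antisymm ?_ (symbPow_le_of_monomial_mem fun d h01 h12 h02 => monomial_mem_symbPow_two_pow m d h01 h12 h02)
  rw [mul_comm]
  exact symbPow_pow_le 2 m

/-- The same, in the «`∀ b`, `I^{(bN)} ≤ (I^{(N)})^b` with `N = 2`» shape of `IsVeroneseStable` / `stableAt_of_veronese`. -/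
theorem symbPow_mul_two_le_pow (b : ℕ) : symbPow (k := k) (b * 2) ≤ symbPow 2 ^ b := by
  rw [symbPow_two_pow, mul_comm]

/-- Level `1` is NOT stable: `I^{(2)} ⊄ (I^{(1)})² = I²` (non-trivial `k`). -/
theorem not_symbPow_two_le_one_sq [Nontrivial k] : ¬ symbPow (k := k) (2 * 1) ≤ symbPow 1 ^ 2 := by
  rw [mul_one, symbPow_one]
  exact fun h => X012_not_mem_sq (h X012_mem_symbPow_two)

end ThreeLines

end CampaignW36

end Summit.ResolutionOfSingularities.ResolutionOfSingularities.Theorems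

end
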